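import Summits.QuantumFields.BalabanUV.Beta.GAN24.FibreRateTBlockRate
import Summits.QuantumFields.BalabanUV.Beta.GAN24.SourceSideMajorant

/-!
# `BalabanUV.Beta.GAN24.FibreRateKingSummand` — binder row G-an2-4 / (CONV-C), road P1-fibre, self-row **P1-Y11t\*** (alias-sum side of p1 row
# L11, division agreed with the L11 owner in CLAIMS l.3039/l.3094), part 5: the GENERIC PER-LABEL ENGINE for King-shaped summands
# `G = (Π_i f_i) · (g/(2ℓ_N) − n/(2ℓ_N²))` — bound and two-level rate from per-factor data

NOT IN PRINT; OUR PROOF ATTEMPT.  HONEST FRAMING (cell contract, verbatim): «discharging `BetaPertH` makes Bałaban's UV stability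
UNCONDITIONAL — a real constructive-QFT result; it is NOT the continuum limit and NOT the Clay problem.»  HONEST DEPENDENCY (verbatim):
«continuum YM on T⁴ ⇐ BetaPertH ∧ nine spine estimates (0/9 proved); BetaPertH ⇐ (D1) ∧ (D4) ∧ CAP+tail; G-an2-4 gates asym, D1 and
NE2/3/4.»  [folklore] product telescoping with majorants over `ℂ` and the scaled-symbol facts of part 2 (`FibreRateTBlockRate`: `inv_ell_le`,
`abs_inv_ell_two_level_le`, `abs_inv_sq_ell_two_level_le`, `wMaj`) and `SourceSideMajorant.norm_prod_sub_prod_le` BY NAME; one harmless data `def` (`xGen`, the generic bracket); NO cited fact,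
NO `def … : Prop`, NO wall binder, NO unit.  NOT summit progress; nothing of (CONV-C)'s K-slot is discharged here.

## What is proved (real label `q ≠ 0` on the extended zone `|q_i| ≤ 5πN/3`, `0 < N ≤ N′`; parameters `B, Bg, ν ≥ 0`; pure-number constants)
All five alias sums of the L11 division (the T-sum `B_N` of parts 1–4 and the reading/source-side sums `R_φ, R_c, S_φ, S_c` of the feed share) have,
after the exact phase cancellations of part 1/part 6, summands of ONE shape: a unimodular level-free phase × `Π_i f_i(N)` × `(g(N)/(2ℓ_N) − n/(2ℓ_N²))`
with per-coordinate factors obeying `‖f_i‖ ≤ B·wMaj Lc q_i`, `‖f_i(N′) − f_i(N)‖ ≤ (6q_i²/N²)·B·wMaj Lc q_i`, a δ-slot `g` with `‖g‖ ≤ Bg`,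
`‖g(N′) − g(N)‖ ≤ (6·momSq q/N²)·Bg`, and a LEVEL-FREE numerator `n` with `‖n‖ ≤ ν` (the `p`-order of the sum is carried by `ν`: `ν = momSq q` for
`B_N, R_φ, S_φ`, `ν ∝ √momSq q` for `R_c, S_c`).  This file proves, once:
* §1 (complex product telescoping with real majorants = `SourceSideMajorant.norm_prod_sub_prod_le` BY NAME), `norm_prod_le`, `norm_prod_two_level_le`
  (`‖Π f′ − Π f‖ ≤ (6·momSq q/N²)·B^D·Π_i wMaj`);
* §2 the bracket `xGen N q g n := g/(2ℓ_N) − n/(2ℓ_N²)`: `‖xGen‖ ≤ 18·Bg/momSq q + 648·ν/momSq q²` and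
  `‖xGen_{N′} g′ − xGen_N g‖ ≤ (216·Bg + 279936·ν/momSq q)/N²` (`‖g‖ ≤ Bg`, `‖g′ − g‖ ≤ (6momSq/N²)Bg`);
* §3 **`norm_king_le`**: `‖(Π f)·xGen‖ ≤ B^D·Π wMaj·(18Bg/momSq + 648ν/momSq²)` and **`norm_king_two_level_le`**:
  `‖(Π f′)·xGen′ − (Π f)·xGen‖ ≤ B^D·Π wMaj·(324·Bg + 283824·ν/momSq q)/N²` — with `B = Bg = 1`, `ν = momSq` this is part 3's `284148`.
-/

noncomputable section

open Complex Finset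
open scoped BigOperators Real
open Literature.MathematicalPhysics.QuantumFieldTheory.King1986 (latticeSymbol momSq momSq_nonneg)
open Summit.QuantumFields.BalabanUV.Beta.GAN24.FibreRateTBlockRate

namespace Summit.QuantumFields.BalabanUV.Beta.GAN24.FibreRateKingSummand

variable {D : ℕ}

/-! ## §1 Product telescoping over `ℂ` with real majorants -/

/-- [folklore] `‖Π_i f_i‖ ≤ B^D·Π_i w_i` from `‖f_i‖ ≤ B·w_i` (`B ≥ 0`). -/
theorem norm_prod_le {f : Fin D → ℂ} {w : Fin D → ℝ} {B : ℝ} (hf : ∀ i, ‖f i‖ ≤ B * w i) :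
    ‖∏ i, f i‖ ≤ B ^ D * ∏ i, w i := by
  rw [norm_prod, show B ^ D = ∏ _i : Fin D, B by rw [Finset.prod_const, Finset.card_univ, Fintype.card_fin], ← Finset.prod_mul_distrib]
  exact Finset.prod_le_prod (fun i _ => norm_nonneg _) fun i _ => hf i

/-- [folklore] **TWO-LEVEL RATE OF THE PRODUCT**: `‖f_i‖, ‖f′_i‖ ≤ B·w_i`, `‖f′_i − f_i‖ ≤ (6q_i²/N²)·B·w_i`, `w_i ≥ 0` ⇒
`‖Π f′ − Π f‖ ≤ (6·momSq q/N²)·B^D·Π_i w_i`. -/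
theorem norm_prod_two_level_le {f f' : Fin D → ℂ} {w : Fin D → ℝ} {B N : ℝ} (hB : 0 ≤ B) (hw : ∀ i, 0 ≤ w i) (q : Fin D → ℝ)
    (hf : ∀ i, ‖f i‖ ≤ B * w i) (hf' : ∀ i, ‖f' i‖ ≤ B * w i) (hrate : ∀ i, ‖f' i - f i‖ ≤ 6 * q i ^ 2 / N ^ 2 * (B * w i)) :
    ‖∏ i, f' i - ∏ i, f i‖ ≤ 6 * momSq q / N ^ 2 * (B ^ D * ∏ i, w i) := by
  classical
  refine (SourceSideMajorant.norm_prod_sub_prod_le Finset.univ f' f (fun i => B * w i) (fun j _ => hf' j) (fun j _ => hf j)).trans ?_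
  have hBD : B ^ D * ∏ i, w i = ∏ i, B * w i := by
    rw [show B ^ D = ∏ _i : Fin D, B by rw [Finset.prod_const, Finset.card_univ, Fintype.card_fin], ← Finset.prod_mul_distrib]
  calc ∑ i, ‖f' i - f i‖ * ∏ j ∈ Finset.univ.erase i, B * w j
      ≤ ∑ i, (6 * q i ^ 2 / N ^ 2 * (B * w i)) * ∏ j ∈ Finset.univ.erase i, B * w j :=
        Finset.sum_le_sum fun i _ => mul_le_mul_of_nonneg_right (hrate i) (Finset.prod_nonneg fun j _ => mul_nonneg hB (hw j))
    _ = ∑ i, 6 * q i ^ 2 / N ^ 2 * ∏ j, B * w j := by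
        refine Finset.sum_congr rfl fun i _ => ?_
        rw [mul_assoc, Finset.mul_prod_erase Finset.univ (fun j => B * w j) (Finset.mem_univ i)]
    _ = 6 * momSq q / N ^ 2 * (B ^ D * ∏ i, w i) := by
        rw [← Finset.sum_mul, hBD]
        congr 1
        rw [momSq, Finset.mul_sum, Finset.sum_div]

/-! ## §2 The generic bracket -/

/-- [folklore] THE GENERIC BRACKET `xGen N q g n = g/(2ℓ_N(q)) − n/(2ℓ_N(q)²)`, `ℓ_N = latticeSymbol N⁻¹ 0 q`. -/
def xGen (N : ℕ) (q : Fin D → ℝ) (g n : ℂ) : ℂ :=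
  g / (2 * ((latticeSymbol ((N : ℝ)⁻¹) 0 q : ℝ) : ℂ)) - n / (2 * ((latticeSymbol ((N : ℝ)⁻¹) 0 q : ℝ) : ℂ) ^ 2)

/-- [folklore] **BOUND OF THE BRACKET**: `‖xGen‖ ≤ 18·Bg/momSq + 648·ν/momSq²` (`q ≠ 0`, extended zone). -/
theorem norm_xGen_le {N : ℕ} (hN : 0 < N) {q : Fin D → ℝ} (hq : ∀ i, |q i| ≤ 5 * π / 3 * (N : ℝ)) (hq0 : q ≠ 0)
    {g n : ℂ} {Bg ν : ℝ} (hg : ‖g‖ ≤ Bg) (hn : ‖n‖ ≤ ν) :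
    ‖xGen N q g n‖ ≤ 18 * Bg / momSq q + 648 * ν / momSq q ^ 2 := by
  have hN' : (0 : ℝ) < N := by exact_mod_cast hN
  have hl := ell_pos hN' hq hq0
  have hil := inv_ell_le hN' hq hq0
  have hm : 0 < momSq q := lt_of_lt_of_le hl (ell_le_momSq hN'.ne' q)
  have hBg : 0 ≤ Bg := (norm_nonneg _).trans hg
  have hν : 0 ≤ ν := (norm_nonneg _).trans hn
  set ℓ := latticeSymbol ((N : ℝ)⁻¹) 0 q with hℓ
  have h1 : ‖g / (2 * (ℓ : ℂ))‖ ≤ 18 * Bg / momSq q := by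
    rw [norm_div, Complex.norm_mul, Complex.norm_ofNat, Complex.norm_real, Real.norm_eq_abs, abs_of_pos hl]
    calc ‖g‖ / (2 * ℓ) = ‖g‖ * ((1 / 2) * ℓ⁻¹) := by rw [inv_eq_one_div]; field_simp
      _ ≤ Bg * ((1 / 2) * (36 / momSq q)) := by gcongr
      _ = 18 * Bg / momSq q := by ring
  have h2 : ‖n / (2 * (ℓ : ℂ) ^ 2)‖ ≤ 648 * ν / momSq q ^ 2 := by
    rw [norm_div, Complex.norm_mul, Complex.norm_ofNat, Complex.norm_pow, Complex.norm_real, Real.norm_eq_abs, abs_of_pos hl]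
    have hl2 : (ℓ ^ 2)⁻¹ ≤ (36 / momSq q) ^ 2 := by
      rw [← inv_pow]; exact pow_le_pow_left₀ (inv_nonneg.2 hl.le) hil 2
    calc ‖n‖ / (2 * ℓ ^ 2) = ‖n‖ * ((1 / 2) * (ℓ ^ 2)⁻¹) := by field_simp
      _ ≤ ν * ((1 / 2) * (36 / momSq q) ^ 2) := by gcongr
      _ = 648 * ν / momSq q ^ 2 := by field_simp; ring
  unfold xGen
  rw [← hℓ]
  exact (norm_sub_le _ _).trans (add_le_add h1 h2)

/-- [folklore] **TWO-LEVEL RATE OF THE BRACKET**: `‖xGen_{N′} g′ n − xGen_N g n‖ ≤ (216·Bg + 279936·ν/momSq q)/N²` (`q ≠ 0`, `0 < N ≤ N′`). -/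
theorem norm_xGen_two_level_le {N N' : ℕ} (hN : 0 < N) (hNN' : N ≤ N') {q : Fin D → ℝ} (hq : ∀ i, |q i| ≤ 5 * π / 3 * (N : ℝ)) (hq0 : q ≠ 0)
    {g g' n : ℂ} {Bg ν : ℝ} (hg : ‖g‖ ≤ Bg) (hgr : ‖g' - g‖ ≤ 6 * momSq q / (N : ℝ) ^ 2 * Bg) (hn : ‖n‖ ≤ ν) :
    ‖xGen N' q g' n - xGen N q g n‖ ≤ (216 * Bg + 279936 * ν / momSq q) / (N : ℝ) ^ 2 := by
  have hN' : (0 : ℝ) < N := by exact_mod_cast hN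
  have hNN'r : (N : ℝ) ≤ N' := by exact_mod_cast hNN'
  have hq' : ∀ i, |q i| ≤ 5 * π / 3 * (N' : ℝ) := fun i => zone_mono hNN'r (hq i)
  have hl := ell_pos hN' hq hq0
  have hl' := ell_pos (lt_of_lt_of_le hN' hNN'r) hq' hq0
  have hil := inv_ell_le hN' hq hq0
  have hil' := inv_ell_le (lt_of_lt_of_le hN' hNN'r) hq' hq0
  have hm : 0 < momSq q := lt_of_lt_of_le hl (ell_le_momSq hN'.ne' q)
  have hrl := abs_inv_ell_two_level_le hN' hNN'r hq hq0
  have hrl2 := abs_inv_sq_ell_two_level_le hN' hNN'r hq hq0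
  have hBg : 0 ≤ Bg := (norm_nonneg _).trans hg
  have hν : 0 ≤ ν := (norm_nonneg _).trans hn
  set ℓ := latticeSymbol ((N : ℝ)⁻¹) 0 q with hℓ
  set ℓ' := latticeSymbol ((N' : ℝ)⁻¹) 0 q with hℓ'
  -- δ-slot: g′/(2ℓ′) − g/(2ℓ) = (g′ − g)/(2ℓ′) + g·(1/(2ℓ′) − 1/(2ℓ))
  have hδ : ‖g' / (2 * (ℓ' : ℂ)) - g / (2 * (ℓ : ℂ))‖ ≤ 216 * Bg / (N : ℝ) ^ 2 := by
    have hl'c : (ℓ' : ℂ) ≠ 0 := by exact_mod_cast hl'.ne'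
    have hlc : (ℓ : ℂ) ≠ 0 := by exact_mod_cast hl.ne'
    have e : g' / (2 * (ℓ' : ℂ)) - g / (2 * (ℓ : ℂ)) = (g' - g) * ((((1:ℝ) / 2 * ℓ'⁻¹ : ℝ)) : ℂ) + g * ((((1:ℝ) / 2 * (ℓ'⁻¹ - ℓ⁻¹) : ℝ)) : ℂ) := by
      push_cast; field_simp; ring
    rw [e]
    refine (norm_add_le _ _).trans ?_
    rw [norm_mul, norm_mul, Complex.norm_real, Complex.norm_real, Real.norm_eq_abs, Real.norm_eq_abs,
      abs_of_nonneg (by positivity : (0:ℝ) ≤ 1 / 2 * ℓ'⁻¹), abs_mul, abs_of_nonneg (by norm_num : (0:ℝ) ≤ 1 / 2)]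
    have t1 : ‖g' - g‖ * (1 / 2 * ℓ'⁻¹) ≤ (6 * momSq q / (N : ℝ) ^ 2 * Bg) * (1 / 2 * (36 / momSq q)) :=
      mul_le_mul hgr (by gcongr) (by positivity) (by positivity)
    have t2 : ‖g‖ * (1 / 2 * |ℓ'⁻¹ - ℓ⁻¹|) ≤ Bg * (1 / 2 * (216 / (N : ℝ) ^ 2)) :=
      mul_le_mul hg (mul_le_mul_of_nonneg_left hrl (by norm_num)) (by positivity) hBg
    calc ‖g' - g‖ * (1 / 2 * ℓ'⁻¹) + ‖g‖ * (1 / 2 * |ℓ'⁻¹ - ℓ⁻¹|)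
        ≤ (6 * momSq q / (N : ℝ) ^ 2 * Bg) * (1 / 2 * (36 / momSq q)) + Bg * (1 / 2 * (216 / (N : ℝ) ^ 2)) := add_le_add t1 t2
      _ = 216 * Bg / (N : ℝ) ^ 2 := by field_simp; ring
  -- n-slot
  have hP : ‖n / (2 * (ℓ' : ℂ) ^ 2) - n / (2 * (ℓ : ℂ) ^ 2)‖ ≤ 279936 * ν / momSq q / (N : ℝ) ^ 2 := by
    have hl'c : (ℓ' : ℂ) ≠ 0 := by exact_mod_cast hl'.ne'
    have hlc : (ℓ : ℂ) ≠ 0 := by exact_mod_cast hl.ne'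
    have e : n / (2 * (ℓ' : ℂ) ^ 2) - n / (2 * (ℓ : ℂ) ^ 2) = n * ((((1:ℝ) / 2 * ((ℓ' ^ 2)⁻¹ - (ℓ ^ 2)⁻¹) : ℝ)) : ℂ) := by
      push_cast; field_simp
    rw [e, norm_mul, Complex.norm_real, Real.norm_eq_abs, abs_mul, abs_of_nonneg (by norm_num : (0:ℝ) ≤ 1 / 2)]
    calc ‖n‖ * (1 / 2 * |(ℓ' ^ 2)⁻¹ - (ℓ ^ 2)⁻¹|) ≤ ν * (1 / 2 * (559872 / ((N : ℝ) ^ 2 * momSq q))) :=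
          mul_le_mul hn (mul_le_mul_of_nonneg_left hrl2 (by norm_num)) (by positivity) hν
      _ = 279936 * ν / momSq q / (N : ℝ) ^ 2 := by field_simp; ring
  unfold xGen
  rw [← hℓ, ← hℓ']
  have e3 : ∀ (A B C E : ℂ), A - B - (C - E) = (A - C) - (B - E) := fun A B C E => by ring
  rw [e3]
  have e4 : 216 * Bg / (N : ℝ) ^ 2 + 279936 * ν / momSq q / (N : ℝ) ^ 2 = (216 * Bg + 279936 * ν / momSq q) / (N : ℝ) ^ 2 := by ring
  exact (norm_sub_le _ _).trans ((add_le_add hδ hP).trans e4.le)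

/-! ## §3 The King-shaped summand: bound and two-level rate -/

/-- [folklore] **BOUND**: `‖(Π f)·xGen‖ ≤ B^D·(Π_i w_i)·(18Bg/momSq + 648ν/momSq²)`. -/
theorem norm_king_le {N : ℕ} (hN : 0 < N) {q : Fin D → ℝ} (hq : ∀ i, |q i| ≤ 5 * π / 3 * (N : ℝ)) (hq0 : q ≠ 0)
    {f : Fin D → ℂ} {w : Fin D → ℝ} {B Bg ν : ℝ} (hB : 0 ≤ B) (hw : ∀ i, 0 ≤ w i) (hf : ∀ i, ‖f i‖ ≤ B * w i)
    {g n : ℂ} (hg : ‖g‖ ≤ Bg) (hn : ‖n‖ ≤ ν) :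
    ‖(∏ i, f i) * xGen N q g n‖ ≤ B ^ D * (∏ i, w i) * (18 * Bg / momSq q + 648 * ν / momSq q ^ 2) := by
  rw [norm_mul]
  exact mul_le_mul (norm_prod_le hf) (norm_xGen_le hN hq hq0 hg hn) (norm_nonneg _)
    (mul_nonneg (pow_nonneg hB _) (Finset.prod_nonneg fun i _ => hw i))

/-- [folklore] **TWO-LEVEL RATE**: `‖(Π f′)·xGen_{N′} g′ n − (Π f)·xGen_N g n‖ ≤ B^D·(Π_i w_i)·(324·Bg + 283824·ν/momSq q)/N²`. -/
theorem norm_king_two_level_le {N N' : ℕ} (hN : 0 < N) (hNN' : N ≤ N') {q : Fin D → ℝ} (hq : ∀ i, |q i| ≤ 5 * π / 3 * (N : ℝ))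
    (hq0 : q ≠ 0) {f f' : Fin D → ℂ} {w : Fin D → ℝ} {B Bg ν : ℝ} (hB : 0 ≤ B) (hw : ∀ i, 0 ≤ w i)
    (hf : ∀ i, ‖f i‖ ≤ B * w i) (hf' : ∀ i, ‖f' i‖ ≤ B * w i) (hfr : ∀ i, ‖f' i - f i‖ ≤ 6 * q i ^ 2 / (N : ℝ) ^ 2 * (B * w i))
    {g g' n : ℂ} (hg : ‖g‖ ≤ Bg) (hg' : ‖g'‖ ≤ Bg) (hgr : ‖g' - g‖ ≤ 6 * momSq q / (N : ℝ) ^ 2 * Bg) (hn : ‖n‖ ≤ ν) :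
    ‖(∏ i, f' i) * xGen N' q g' n - (∏ i, f i) * xGen N q g n‖ ≤
      B ^ D * (∏ i, w i) * (324 * Bg + 283824 * ν / momSq q) / (N : ℝ) ^ 2 := by
  have hN' : (0 : ℝ) < N := by exact_mod_cast hN
  have hNN'r : (N : ℝ) ≤ N' := by exact_mod_cast hNN'
  have hq' : ∀ i, |q i| ≤ 5 * π / 3 * (N' : ℝ) := fun i => zone_mono hNN'r (hq i)
  have hl := ell_pos hN' hq hq0
  have hm : 0 < momSq q := lt_of_lt_of_le hl (ell_le_momSq hN'.ne' q)
  have hBg : 0 ≤ Bg := (norm_nonneg _).trans hg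
  have hν : 0 ≤ ν := (norm_nonneg _).trans hn
  have hW : 0 ≤ B ^ D * ∏ i, w i := mul_nonneg (pow_nonneg hB _) (Finset.prod_nonneg fun i _ => hw i)
  have hP := norm_prod_two_level_le hB hw q hf hf' hfr
  have hPb := norm_prod_le hf
  have hX := norm_xGen_two_level_le hN hNN' hq hq0 hg hgr hn
  have hX'b := norm_xGen_le (lt_of_lt_of_le hN hNN') hq' hq0 hg' hn
  have key := ClosedFormRateOfParts.norm_mul_sub_mul_le (∏ i, f i) (∏ i, f' i) (xGen N q g n) (xGen N' q g' n)
  refine key.trans ?_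
  calc ‖∏ i, f' i - ∏ i, f i‖ * ‖xGen N' q g' n‖ + ‖∏ i, f i‖ * ‖xGen N' q g' n - xGen N q g n‖
      ≤ (6 * momSq q / (N : ℝ) ^ 2 * (B ^ D * ∏ i, w i)) * (18 * Bg / momSq q + 648 * ν / momSq q ^ 2) +
          (B ^ D * ∏ i, w i) * ((216 * Bg + 279936 * ν / momSq q) / (N : ℝ) ^ 2) := by
        gcongr
    _ = B ^ D * (∏ i, w i) * (324 * Bg + 283824 * ν / momSq q) / (N : ℝ) ^ 2 := by field_simp; ring

end Summit.QuantumFields.BalabanUV.Beta.GAN24.FibreRateKingSummand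

end
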